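import Summits.Ventures.Crystal3D.Theorems.StickyWulffConstantPolycrystalWulffBoundRungInclined
import Summits.Ventures.Crystal3D.Theorems.StickyWulffConstantPolycrystalWulffBoundQuantileLower
import Summits.Ventures.Crystal3D.Theorems.StickyWulffConstantPolycrystalWulffBoundPerSelf

/-!
# `PolycrystalWulffBound`, line `PolyDensity`: the charged-wall rung with a CHOICE-FREE hypothesis —
# `rung_inclinedLamellar_of_cdfShift` (crux `stmt-Ventures-19482`)

Route `StickyWulffConstant` of the venture `Summits/Ventures/Crystal3D`, second prover lane (poly-p2,
gen 8).  `rung_inclinedLamellar_of_quantiles` (`…RungInclined`) takes quantile functions as data.  Here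
they are CONSTRUCTED (`exists_lowerQuantile_of_isCompact`, bodies `W(A_f) ⊆ B̄(0,√5)`, volume `32`) and the
only remaining hypothesis on the bodies is the CDF SHIFT between consecutive lamellae:
  `|W(A_{f+1}) ∩ {⟪y,n⟫ < t}| ≤ |W(A_f) ∩ {⟪y,n⟫ < t + δ}|`  for all `t`
(for the crux's twins `W`, `R_m W` this is the 1-D statement «SectionShift n δ»; numerically
`δ ≤ sin∠(n,m)/√6`, seat memo P-TWIN-g8 §2a).  CONCLUSION: `6·2^{1/3}(√2·Vol)^{2/3} ≤ Fr + δ·Σ_f S_f`.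
WHAT THIS IS NOT: the value of `δ`; `S_f = |wall_f|`; the crux is not claimed. -/

noncomputable section

open scoped BigOperators InnerProductSpace ENNReal Pointwise Topology
open MeasureTheory Filter Set

namespace Summit.Ventures.Crystal3D.Cruxes.PolycrystalWulffBound.PolyDensity

open Summit.Ventures.Crystal3D.Theorems
open Summit.Ventures.Crystal3D.Cruxes.TextureLiminf.TexShadow (per polytope E3)
open Literature.MathematicalPhysics.StatisticalMechanics (fccStacking barlowStacking IsHaggSeq perimeter)

/-- **Rung `rung_inclinedLamellar_of_cdfShift`**: inclined lamellar textures whose consecutive bodies'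
cumulative section volumes along `n` are `δ`-shifts of each other satisfy
`6·2^{1/3}(√2·Vol)^{2/3} ≤ Fr + δ·Σ S_f`. -/
theorem rung_inclinedLamellar_of_cdfShift : let Λ : Set (EuclideanSpace ℝ (Fin 3)) := Literature.MathematicalPhysics.StatisticalMechanics.fccStacking 1 (Real.sqrt (2 / 3)); let Φ : EuclideanSpace ℝ (Fin 3) → ℝ := fun ν => Real.sqrt 2 / 4 * ∑ᶠ w ∈ {w ∈ Λ | ‖w‖ = 1}, |⟪w, ν⟫_ℝ|; let Per : Set (EuclideanSpace ℝ (Fin 3)) → Set (EuclideanSpace ℝ (Fin 3)) → ℝ := fun K S => (⨆ (ξ : EuclideanSpace ℝ (Fin 3) → EuclideanSpace ℝ (Fin 3)) (_ : ContDiff ℝ 1 ξ ∧ HasCompactSupport ξ ∧ ∀ z, ξ z ∈ K), ENNReal.ofReal (∫ z in S, Literature.MathematicalPhysics.StatisticalMechanics.fieldDivergence ξ z)).toReal; let ι : Set (EuclideanSpace ℝ (Fin 3)) → Set (EuclideanSpace ℝ (Fin 3)) → Set (EuclideanSpace ℝ (Fin 3)) → ℝ := fun K S₁ S₂ => (Per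 K S₁ + Per K S₂ - Per K (S₁ ∪ S₂)) / 2; let W : (EuclideanSpace ℝ (Fin 3) ≃ₗᵢ[ℝ] EuclideanSpace ℝ (Fin 3)) → Set (EuclideanSpace ℝ (Fin 3)) := fun A => {y | ∀ ν : EuclideanSpace ℝ (Fin 3), ⟪y, ν⟫_ℝ ≤ Φ (A.symm ν)}; let Vol : (n : ℕ) → (Fin n → Set (EuclideanSpace ℝ (Fin 3))) → ℝ := fun n G => (volume (⋃ f : Fin n, G f)).toReal; let Poly : Set (EuclideanSpace ℝ (Fin 3)) → Prop := fun S => ∃ (k : ℕ) (H : Fin k → Finset ((EuclideanSpace ℝ (Fin 3)) × ℝ)), S = ⋃ i, ⋂ p ∈ H i, {x | ⟪p.1, x⟫_ℝ < p.2}; let Fr : (n : ℕ) → (Fin n → Set (EuclideanSpace ℝ (Fin 3))) → (Fin n → (EuclideanSpace ℝ (Fin 3) ≃ₗᵢ[ℝ] EuclideanSpace ℝ (Fin 3))) → ℝ := fun n G A => ∑ f : Fin n, Per (W (A f)) (G f) - ∑ f, ∑ g, (if f = g then 0 else ι (W (A f)) (G f) (G g)); ∀ (E : Set (EuclideanSpace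 ℝ (Fin 3))), Poly E → volume E < ⊤ → ∀ (n : EuclideanSpace ℝ (Fin 3)), ‖n‖ = 1 → ∀ (k : ℕ) (a : Fin (k + 1) → ℝ), StrictMono a → ∀ (A : Fin k → (EuclideanSpace ℝ (Fin 3) ≃ₗᵢ[ℝ] EuclideanSpace ℝ (Fin 3))) (δ : ℝ) (S : Fin k → ℝ), 0 ≤ δ → (∀ (f g : Fin k), (f : ℕ) + 1 = g → ∀ t : ℝ, volume (W (A g) ∩ {y | ⟪y, n⟫_ℝ < t}) ≤ volume (W (A f) ∩ {y | ⟪y, n⟫_ℝ < t + δ})) → (∀ f, 0 ≤ S f) → (∀ f (h : ℝ), 0 < h → volume (E ∩ {x | a f.succ - h ≤ ⟪x, n⟫_ℝ ∧ ⟪x, n⟫_ℝ < a f.succ}) ≤ ENNReal.ofReal (h * S f)) → 6 * (2 : ℝ) ^ ((1 : ℝ) / 3) * (Real.sqrt 2 * Vol k (fun f => E ∩ {x | a f.castSucc < ⟪x, n⟫_ℝ ∧ ⟪x, n⟫_ℝ < a f.succ})) ^ ((2 : ℝ) / 3) ≤ Fr k (fun f => E ∩ {x | a f.castSucc < ⟪x,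 n⟫_ℝ ∧ ⟪x, n⟫_ℝ < a f.succ}) A + δ * ∑ f, S f := by
  intro Λ Φ Per ι W Vol Poly Fr E hE hEv n hn k a ha A δ S hδ hshift hS0 hS
  -- lower quantile functions of the bodies
  have hdata : ∀ f, ∃ q : ℝ → ℝ, (∀ σ, |q σ| ≤ Real.sqrt 5 + 1) ∧
      (∀ σ₁ σ₂, 0 ≤ σ₁ → σ₁ ≤ σ₂ → σ₂ ≤ 1 →
        ENNReal.ofReal ((σ₂ - σ₁) * 32) ≤ volume (W (A f) ∩ {y : E3 | q σ₁ < ⟪y, n⟫_ℝ ∧ ⟪y, n⟫_ℝ < q σ₂})) ∧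
      (∀ σ, 0 ≤ σ → σ ≤ 1 → (volume (W (A f) ∩ {y : E3 | ⟪y, n⟫_ℝ < q σ})).toReal = σ * 32) ∧
      (∀ σ t, 0 ≤ σ → σ ≤ 1 → -(Real.sqrt 5 + 1) ≤ t →
        ENNReal.ofReal (σ * 32) ≤ volume (W (A f) ∩ {y : E3 | ⟪y, n⟫_ℝ < t}) → q σ ≤ t) :=
    fun f => exists_lowerQuantile_of_isCompact n hn (W (A f)) (isCompact_cruxWulffBody (A f))
      (Real.sqrt_nonneg 5) (cruxWulffBody_subset_closedBall (A f)) (by norm_num) (volume_cruxWulffBody (A f))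
  choose q hqb hqmass hqval hqmin using hdata
  have hfin : ∀ f t, volume (W (A f) ∩ {y : E3 | ⟪y, n⟫_ℝ < t}) ≠ ⊤ := fun f t =>
    ne_top_of_le_ne_top (isCompact_cruxWulffBody (A f)).measure_lt_top.ne (measure_mono inter_subset_left)
  have hqq : ∀ (f g : Fin k) (σ : ℝ), (f : ℕ) + 1 = g → 0 ≤ σ → σ ≤ 1 → q f σ ≤ q g σ + δ := by
    intro f g σ hfg h0 h1
    exact lowerQuantile_le_add_of_cdf_le n (W (A f)) (W (A g)) hδ (q f) (q g) (hqval g) (hqb g)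
      (hfin g) (hqmin f) (hshift f g hfg) σ h0 h1
  exact rung_inclinedLamellar_of_quantiles E hE hEv n hn k a ha A q (Real.sqrt 5 + 1) δ S hqmass
    (fun f σ _ _ => hqb f σ) hδ hqq hS0 hS

end Summit.Ventures.Crystal3D.Cruxes.PolycrystalWulffBound.PolyDensity

end
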